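import Summits.AtomisticToContinuum.Crystallization.Theorems.ThreeConeCertificateSlackRigidityRodLemmaD

/-!
# The 1-D spectral lemma of line `signed-root-silent-field` — part E: the sampling property of `Q₀`;
# the third-difference test function

The registered stub `stub_rodLemma` (skeleton `Cruxes/SlackRigidity/Lines/signed-root-silent-field.lean`,
lead c2; crux `SlackRigidity`, stmt-AtomisticToContinuum-11960): a bounded sequence `u : ℤ → ℂ` with
`Σ_k u_k c(t − kh) = 0` for all real `t`, where `c` is continuous, `O((1+|t|)⁻²)`, and `𝓕c` is `C²`
and zero-free on `(1/(2h), 1/h) ∪ (−1/h, −1/(2h))`, is `2`-periodic.  Proof WITHOUT Wiener division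
or distributions: test the identity against `𝓕(φ/𝓕c)` (multiplication formula) to annihilate every
`C_c²` test function supported in a good interval; integer translates of the two good intervals cover
`ℝ ∖ ½ℤ`; shrinking bumps extend the annihilation to test functions with vanishing `2`-jets on `½ℤ`;
pairing with `𝐞(k₀·)(𝐞(2·) − 1)³ Q₀` (`𝓕Q₀|_ℤ = q δ₀`) gives a vanishing third difference of
`n ↦ u(k₀ + 2n)`, and a bounded sequence with vanishing third difference is constant.
All `[folklore]` (Rudin, *Functional Analysis* Thm 9.3; Katznelson, *Harmonic Analysis* Ch. VI).

This part: `𝓕Q₀(j) = 0` for integers `j ≠ 0` (so `𝓕Q₀|_ℤ = 𝓕Q₀(0)·δ₀`), modulation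
`𝓕(𝐞(a·)f) = 𝓕f(· − a)`, the test function `D = 𝐞(k₀·)·Q₀·(𝐞(2·)−1)³` (`C_c²`, vanishing `2`-jets
on `½ℤ`), and `Σ_k u_k 𝓕D(k) = q·(third difference of u)`.
-/

noncomputable section

open scoped BigOperators Topology FourierTransform Real
open MeasureTheory Filter Set Complex

namespace Summit.AtomisticToContinuum.Crystallization.Theorems.SignedRootRodLemma

section Q0

/-- The complexified step and its derivative. [folklore] -/
def stepC (y : ℝ) : ℂ := ((stepS y : ℝ) : ℂ)

/-- `stepC` is `C²`. [folklore] -/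
theorem stepC_contDiff : ContDiff ℝ 2 stepC :=
  (ofRealCLM.contDiff.of_le le_top).comp (stepS_contDiff (n := 2))

/-- The derivative of the complexified step has compact support (in `[−1/4, 1/4]`). [folklore] -/
theorem hasCompactSupport_deriv_stepC : HasCompactSupport (deriv stepC) := by
  refine HasCompactSupport.intro (isCompact_closedBall (0 : ℝ) (1 / 4)) fun x hx => ?_
  rw [Metric.mem_closedBall, dist_zero_right, Real.norm_eq_abs, not_le] at hx
  -- `stepC` is locally constant near `x`
  rcases lt_abs.1 hx with h | h
  · have hopen : IsOpen {z : ℝ | 1 / 4 < z} := isOpen_lt continuous_const continuous_id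
    have hev : stepC =ᶠ[𝓝 x] fun _ => (1 : ℂ) := by
      filter_upwards [hopen.mem_nhds h] with z hz
      rw [stepC, stepS_eq_one (le_of_lt hz), Complex.ofReal_one]
    rw [hev.deriv_eq]; exact deriv_const x 1
  · have hopen : IsOpen {z : ℝ | z < -(1 / 4)} := isOpen_lt continuous_id continuous_const
    have hev : stepC =ᶠ[𝓝 x] fun _ => (0 : ℂ) := by
      filter_upwards [hopen.mem_nhds (by linarith : x < -(1 / 4))] with z hz
      rw [stepC, stepS_eq_zero (le_of_lt hz), Complex.ofReal_zero]
    rw [hev.deriv_eq]; exact deriv_const x 0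

/-- `Q₀ = stepC(· + 1/2) − stepC(· − 1/2)` and its derivative. [folklore] -/
theorem deriv_Q₀ : deriv Q₀ = fun x => deriv stepC (x + 1 / 2) - deriv stepC (x - 1 / 2) := by
  have hd : Differentiable ℝ stepC := stepC_contDiff.differentiable (by norm_num)
  funext x
  have e : Q₀ = fun x => stepC (x + 1 / 2) - stepC (x - 1 / 2) := by
    funext y; simp [Q₀, Q₀r, stepC]
  rw [e]
  have h1 : HasDerivAt (fun x => stepC (x + 1 / 2)) (deriv stepC (x + 1 / 2)) x := by
    simpa using HasDerivAt.comp_add_const x (1 / 2) (hd (x + 1 / 2)).hasDerivAt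
  have h2 : HasDerivAt (fun x => stepC (x - 1 / 2)) (deriv stepC (x - 1 / 2)) x := by
    simpa using HasDerivAt.comp_sub_const x (1 / 2) (hd (x - 1 / 2)).hasDerivAt
  exact (h1.sub h2).deriv

/-- **`𝓕Q₀(j) = 0` for every nonzero integer `j`**: `𝓕(Q₀') = 2πiξ·𝓕Q₀` and
`𝓕(Q₀')(j) = (𝐞(j/2) − 𝐞(−j/2))·𝓕(stepC')(j) = 0`. [folklore] -/
theorem fourier_Q₀_int_eq_zero {j : ℤ} (hj : j ≠ 0) : 𝓕 Q₀ j = 0 := by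
  have hQi : Integrable Q₀ := Q₀_contDiff.continuous.integrable_of_hasCompactSupport Q₀_hasCompactSupport
  have hQd : Differentiable ℝ Q₀ := Q₀_contDiff.differentiable (by norm_num)
  have hQ's : HasCompactSupport (deriv Q₀) := Q₀_hasCompactSupport.deriv
  have hQ'c : Continuous (deriv Q₀) := Q₀_contDiff.continuous_deriv (by norm_num)
  have hQ'i : Integrable (deriv Q₀) := hQ'c.integrable_of_hasCompactSupport hQ's
  -- the derivative of the step: integrable with compact support
  set T : ℝ → ℂ := deriv stepC with hT
  have hTc : Continuous T := stepC_contDiff.continuous_deriv (by norm_num)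
  have hTi : Integrable T := hTc.integrable_of_hasCompactSupport hasCompactSupport_deriv_stepC
  -- `𝓕 (Q₀') j = 0`
  have hderiv : 𝓕 (deriv Q₀) j = 0 := by
    rw [deriv_Q₀]
    have e : (fun x => deriv stepC (x + 1 / 2) - deriv stepC (x - 1 / 2)) =
        fun x => T (x - (-(1 / 2))) + (-1 : ℂ) * T (x - 1 / 2) := by
      funext x; rw [hT]; ring_nf
    rw [e]
    have hint1 : Integrable (fun x => T (x - (-(1 / 2)))) := hTi.comp_sub_right _
    have hint2 : Integrable (fun x => (-1 : ℂ) * T (x - 1 / 2)) := (hTi.comp_sub_right _).const_mul _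
    have hlin : 𝓕 (fun x => T (x - (-(1 / 2))) + (-1 : ℂ) * T (x - 1 / 2)) j =
        𝓕 (fun x => T (x - (-(1 / 2)))) j + (-1 : ℂ) * 𝓕 (fun x => T (x - 1 / 2)) j := by
      simp only [Real.fourier_real_eq]
      have hi1 : Integrable (fun v : ℝ => 𝐞 (-(v * (j : ℝ))) • T (v - (-(1 / 2)))) := by
        have h := (Real.fourierIntegral_convergent_iff (μ := volume)
          (f := fun x => T (x - (-(1 / 2)))) (j : ℝ)).2 hint1
        simp only [Real.inner_apply] at h
        simpa [mul_comm] using h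
      have hi2 : Integrable (fun v : ℝ => 𝐞 (-(v * (j : ℝ))) • ((-1 : ℂ) * T (v - 1 / 2))) := by
        have h := (Real.fourierIntegral_convergent_iff (μ := volume)
          (f := fun x => (-1 : ℂ) * T (x - 1 / 2)) (j : ℝ)).2 hint2
        simp only [Real.inner_apply] at h
        simpa [mul_comm] using h
      simp_rw [smul_add]
      rw [integral_add hi1 hi2]
      congr 1
      rw [← integral_const_mul]
      congr 1
      funext v
      rw [Circle.smul_def, Circle.smul_def, smul_eq_mul, smul_eq_mul]
      ring
    rw [hlin]
    rw [fourier_comp_sub_const, fourier_comp_sub_const]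
    -- `𝐞(j/2) = 𝐞(−j/2)` for integer `j`
    have hchar : (𝐞 (-((j : ℝ) * -(1 / 2))) : ℂ) = 𝐞 (-((j : ℝ) * (1 / 2))) := by
      rw [Real.fourierChar_apply, Real.fourierChar_apply, Complex.exp_eq_exp_iff_exists_int]
      refine ⟨j, ?_⟩
      push_cast
      ring
    rw [hchar]
    ring
  -- `𝓕 (Q₀') = 2πiξ 𝓕 Q₀`
  have h := Real.fourier_deriv hQi hQd hQ'i
  have hj' := congrFun h (j : ℝ)
  rw [hderiv] at hj'
  have hne : (2 * (π : ℂ) * I * (j : ℝ)) ≠ 0 := by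
    have hπ : (π : ℂ) ≠ 0 := by exact_mod_cast Real.pi_ne_zero
    have hjc : ((j : ℝ) : ℂ) ≠ 0 := by exact_mod_cast hj
    exact mul_ne_zero (mul_ne_zero (mul_ne_zero two_ne_zero hπ) Complex.I_ne_zero) hjc
  rw [smul_eq_mul, eq_comm, mul_eq_zero] at hj'
  exact hj'.resolve_left hne

/-- **Sampling property**: on integers, `𝓕Q₀` is `𝓕Q₀(0)·δ₀`. [folklore] -/
theorem fourier_Q₀_int (j : ℤ) : 𝓕 Q₀ j = if j = 0 then 𝓕 Q₀ 0 else 0 := by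
  split_ifs with h
  · rw [h, Int.cast_zero]
  · exact fourier_Q₀_int_eq_zero h

end Q0

/-- The character `x ↦ 𝐞(a x)` as a complex function: `modC a x = exp(2πi a x)`. [folklore] -/
def modC (a : ℝ) (x : ℝ) : ℂ := Complex.exp (2 * π * I * a * x)

/-- `modC a x = 𝐞(x a)`. [folklore] -/
theorem modC_eq_fourierChar (a x : ℝ) : modC a x = 𝐞 (x * a) := by
  rw [modC, Real.fourierChar_apply]; congr 1; push_cast; ring

/-- `modC a` is smooth. [folklore] -/
theorem modC_contDiff (a : ℝ) : ContDiff ℝ 2 (modC a) := by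
  have h0 : ContDiff ℝ 2 (fun x : ℝ => (x : ℂ)) := Complex.ofRealCLM.contDiff
  have h1 : ContDiff ℝ 2 (fun x : ℝ => 2 * π * I * a * (x : ℂ)) := contDiff_const.mul h0
  exact ((Complex.contDiff_exp (𝕜 := ℂ) (n := 2)).restrict_scalars ℝ).comp h1

/-- `modC a` at half-integers for integer `a`: `modC a (m/2) = (−1)^{a m}`; in particular it is
`1` when `m` is even and `(−1)^a` when `m` is odd. [folklore] -/
theorem modC_int_half (a m : ℤ) : modC a ((m : ℝ) / 2) = (-1 : ℂ) ^ (a * m).natAbs := by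
  rw [modC]
  have e : (2 * (π : ℂ) * I * (a : ℝ) * (((m : ℝ) / 2 : ℝ) : ℂ)) = ((a * m : ℤ) : ℂ) * (π * I) := by
    push_cast; ring
  rw [e]
  obtain ⟨n, hn | hn⟩ := Int.even_or_odd' (a * m)
  · rw [hn]
    have : (((2 * n : ℤ) : ℂ)) * (π * I) = (n : ℂ) * (2 * π * I) := by push_cast; ring
    rw [this, Complex.exp_int_mul_two_pi_mul_I]
    have heven : Even (2 * n).natAbs := by rw [Int.natAbs_mul]; exact even_two_mul _
    rw [heven.neg_one_pow]
  · rw [hn]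
    have : (((2 * n + 1 : ℤ) : ℂ)) * (π * I) = (n : ℂ) * (2 * π * I) + π * I := by push_cast; ring
    rw [this, Complex.exp_add, Complex.exp_int_mul_two_pi_mul_I, Complex.exp_pi_mul_I, one_mul]
    have hodd : Odd (2 * n + 1).natAbs := Int.natAbs_odd.2 ⟨n, rfl⟩
    rw [hodd.neg_one_pow]

/-- **Modulation shifts the Fourier transform**: `𝓕(modC a · f)(w) = 𝓕f(w − a)`. [folklore] -/
theorem fourier_modC_mul (a : ℝ) (f : ℝ → ℂ) (w : ℝ) :
    𝓕 (fun x => modC a x * f x) w = 𝓕 f (w - a) := by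
  simp only [Real.fourier_real_eq, Circle.smul_def, smul_eq_mul]
  congr 1
  funext v
  rw [modC_eq_fourierChar, ← mul_assoc, ← Circle.coe_mul, ← AddChar.map_add_eq_mul]
  congr 2
  ring

/-- The basic trigonometric factor `G(x) = 𝐞(2x) − 1`, vanishing exactly on the half-integers. [folklore] -/
def trigG (x : ℝ) : ℂ := modC 2 x - 1

/-- `G` vanishes on the half-integer grid. [folklore] -/
theorem trigG_half_int (m : ℤ) : trigG ((m : ℝ) / 2) = 0 := by
  have h := modC_int_half 2 m
  have heven : Even (2 * m).natAbs := by rw [Int.natAbs_mul]; exact even_two_mul _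
  rw [heven.neg_one_pow] at h
  push_cast at h
  rw [trigG, h, sub_self]

/-- `G` is smooth. [folklore] -/
theorem trigG_contDiff : ContDiff ℝ 2 trigG := (modC_contDiff 2).sub contDiff_const

/-- `G³` expands into characters: `(𝐞(2x) − 1)³ = 𝐞(6x) − 3𝐞(4x) + 3𝐞(2x) − 1`. [folklore] -/
theorem trigG_pow_three (x : ℝ) :
    trigG x ^ 3 = modC 6 x - 3 * modC 4 x + 3 * modC 2 x - 1 := by
  have h2 : modC 2 x ^ 2 = modC 4 x := by
    rw [modC, modC, ← Complex.exp_nat_mul]; congr 1; push_cast; ring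
  have h3 : modC 2 x ^ 3 = modC 6 x := by
    rw [modC, modC, ← Complex.exp_nat_mul]; congr 1; push_cast; ring
  rw [trigG]
  ring_nf
  rw [h2, h3]
  ring

/-- **A product with the cube of a function vanishing at `p` has vanishing `2`-jet at `p`.** [folklore] -/
theorem jets_zero_of_mul_cube {F G : ℝ → ℂ} (hF : ContDiff ℝ 2 F) (hG : ContDiff ℝ 2 G) {p : ℝ}
    (hp : G p = 0) :
    (fun x => F x * G x ^ 3) p = 0 ∧ deriv (fun x => F x * G x ^ 3) p = 0 ∧
      deriv (deriv (fun x => F x * G x ^ 3)) p = 0 := by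
  have hF1 : Differentiable ℝ F := hF.differentiable (by norm_num)
  have hG1 : Differentiable ℝ G := hG.differentiable (by norm_num)
  have hG2 : Differentiable ℝ (deriv G) := hG.differentiable_deriv_two
  have hc : ContDiff ℝ 2 (fun x => G x ^ 3) := hG.pow 3
  -- first derivative of `G³`, in the form `G · H` with `H = 3 G G'`
  have hcube : ∀ x, HasDerivAt (fun x => G x ^ 3) (G x * (3 * G x * deriv G x)) x := by
    intro x
    have h := (hG1 x).hasDerivAt.fun_pow 3
    rw [show (3 : ℕ) - 1 = 2 from rfl] at h
    have e : ((3 : ℕ) : ℂ) * G x ^ 2 * deriv G x = G x * (3 * G x * deriv G x) := by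
      push_cast; ring
    rw [e] at h
    exact h
  have hderiv1 : deriv (fun x => G x ^ 3) = fun x => G x * (3 * G x * deriv G x) :=
    funext fun x => (hcube x).deriv
  have hH : ∀ x, DifferentiableAt ℝ (fun x => 3 * G x * deriv G x) x := fun x =>
    (((hG1 x).const_mul (3 : ℂ)).mul (hG2 x))
  refine ⟨?_, ?_, ?_⟩
  · show F p * G p ^ 3 = 0
    rw [hp]; ring
  · have hFG : HasDerivAt (fun x => F x * G x ^ 3)
        (deriv F p * G p ^ 3 + F p * (G p * (3 * G p * deriv G p))) p :=
      (hF1 p).hasDerivAt.mul (hcube p)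
    rw [hFG.deriv, hp]
    ring
  · rw [deriv_deriv_mul hF hc p, hderiv1]
    have hGH : HasDerivAt (fun x => G x * (3 * G x * deriv G x))
        (deriv G p * (3 * G p * deriv G p) + G p * deriv (fun x => 3 * G x * deriv G x) p) p :=
      (hG1 p).hasDerivAt.mul (hH p).hasDerivAt
    rw [hGH.deriv]
    simp [hp]

/-- **The third-difference test function** `D_{k₀} = modC k₀ · G³ · Q₀`: `C_c²`, vanishing `2`-jets
on the half-integer grid. [folklore] -/
def testD (k₀ : ℤ) (x : ℝ) : ℂ := (modC k₀ x * Q₀ x) * trigG x ^ 3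

/-- `testD k₀` is `C²`. [folklore] -/
theorem testD_contDiff (k₀ : ℤ) : ContDiff ℝ 2 (testD k₀) :=
  ((modC_contDiff _).mul Q₀_contDiff).mul (trigG_contDiff.pow 3)

/-- `testD k₀` has compact support. [folklore] -/
theorem testD_hasCompactSupport (k₀ : ℤ) : HasCompactSupport (testD k₀) := by
  unfold testD
  exact (Q₀_hasCompactSupport.mul_left).mul_right

/-- `testD k₀` has vanishing `2`-jets on the half-integer grid. [folklore] -/
theorem testD_jets (k₀ m : ℤ) :
    testD k₀ ((m : ℝ) / 2) = 0 ∧ deriv (testD k₀) ((m : ℝ) / 2) = 0 ∧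
      deriv (deriv (testD k₀)) ((m : ℝ) / 2) = 0 := by
  have h := jets_zero_of_mul_cube ((modC_contDiff (k₀ : ℝ)).mul Q₀_contDiff) trigG_contDiff
    (trigG_half_int m)
  exact h

/-- **Fourier transform of `testD` at integers**: a third difference of shifted sampling values,
`𝓕D(k) = 𝓕Q₀(k−k₀−6) − 3𝓕Q₀(k−k₀−4) + 3𝓕Q₀(k−k₀−2) − 𝓕Q₀(k−k₀)`. [folklore] -/
theorem fourier_testD (k₀ : ℤ) (w : ℝ) :
    𝓕 (testD k₀) w = 𝓕 Q₀ (w - (k₀ + 6)) - 3 * 𝓕 Q₀ (w - (k₀ + 4)) + 3 * 𝓕 Q₀ (w - (k₀ + 2)) -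
      𝓕 Q₀ (w - k₀) := by
  -- expand `testD` into four modulated copies of `Q₀`
  have hmul : ∀ (a b : ℝ) (x : ℝ), modC a x * modC b x = modC (a + b) x := by
    intro a b x; rw [modC, modC, modC, ← Complex.exp_add]; congr 1; push_cast; ring
  have e : testD k₀ = fun x => modC (k₀ + 6) x * Q₀ x + ((-3 : ℂ) * (modC (k₀ + 4) x * Q₀ x) +
      ((3 : ℂ) * (modC (k₀ + 2) x * Q₀ x) + (-1 : ℂ) * (modC k₀ x * Q₀ x))) := by
    funext x
    rw [testD, trigG_pow_three, ← hmul, ← hmul, ← hmul]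
    ring
  have hint : ∀ a : ℝ, Integrable (fun x => modC a x * Q₀ x) := fun a =>
    ((modC_contDiff a).mul Q₀_contDiff).continuous.integrable_of_hasCompactSupport
      Q₀_hasCompactSupport.mul_left
  have hint' : ∀ (c : ℂ) (a : ℝ), Integrable (fun x => c * (modC a x * Q₀ x)) := fun c a =>
    (hint a).const_mul c
  -- linearity, term by term (via the integral form)
  have hchar : ∀ (q : ℝ → ℂ), Integrable q → Integrable (fun v : ℝ => 𝐞 (-(v * w)) • q v) := by
    intro q hq
    have h := (Real.fourierIntegral_convergent_iff (μ := volume) (f := q) w).2 hq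
    simp only [Real.inner_apply] at h
    simpa [mul_comm] using h
  have hadd : ∀ (f g : ℝ → ℂ), Integrable f → Integrable g →
      𝓕 (fun x => f x + g x) w = 𝓕 f w + 𝓕 g w := by
    intro f g hf hg
    simp only [Real.fourier_real_eq, smul_add]
    exact integral_add (hchar f hf) (hchar g hg)
  have hsmul : ∀ (c : ℂ) (f : ℝ → ℂ), 𝓕 (fun x => c * f x) w = c * 𝓕 f w := by
    intro c f
    simp only [Real.fourier_real_eq, Circle.smul_def, smul_eq_mul]
    rw [← integral_const_mul]
    congr 1; funext v; ring
  rw [e]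
  rw [hadd (fun x => modC (k₀ + 6) x * Q₀ x)
      (fun x => (-3 : ℂ) * (modC (k₀ + 4) x * Q₀ x) +
        ((3 : ℂ) * (modC (k₀ + 2) x * Q₀ x) + (-1 : ℂ) * (modC k₀ x * Q₀ x)))
      (hint _) ((hint' _ _).add ((hint' _ _).add (hint' _ _)))]
  rw [hadd (fun x => (-3 : ℂ) * (modC (k₀ + 4) x * Q₀ x))
      (fun x => (3 : ℂ) * (modC (k₀ + 2) x * Q₀ x) + (-1 : ℂ) * (modC k₀ x * Q₀ x))
      (hint' _ _) ((hint' _ _).add (hint' _ _))]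
  rw [hadd (fun x => (3 : ℂ) * (modC (k₀ + 2) x * Q₀ x)) (fun x => (-1 : ℂ) * (modC k₀ x * Q₀ x))
      (hint' _ _) (hint' _ _)]
  rw [hsmul (-3) (fun x => modC (k₀ + 4) x * Q₀ x), hsmul 3 (fun x => modC (k₀ + 2) x * Q₀ x),
    hsmul (-1) (fun x => modC k₀ x * Q₀ x)]
  rw [fourier_modC_mul, fourier_modC_mul, fourier_modC_mul, fourier_modC_mul]
  ring

/-- **The third difference of `u` with step `2` vanishes** (pairing `testD` with `u`): if
`Σ_k u_k 𝓕φ(k) = 0` for every `C_c²` function with vanishing `2`-jets on the grid, then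
`u(k₀+6) − 3u(k₀+4) + 3u(k₀+2) − u(k₀) = 0`. [folklore] -/
theorem third_difference_eq_zero {u : ℤ → ℂ}
    (hann : ∀ φ : ℝ → ℂ, ContDiff ℝ 2 φ → HasCompactSupport φ →
      (∀ m : ℤ, φ ((m : ℝ) / 2) = 0 ∧ deriv φ ((m : ℝ) / 2) = 0 ∧ deriv (deriv φ) ((m : ℝ) / 2) = 0) →
      HasSum (fun k : ℤ => u k * 𝓕 φ k) 0)
    (k₀ : ℤ) : u (k₀ + 6) - 3 * u (k₀ + 4) + 3 * u (k₀ + 2) - u k₀ = 0 := by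
  set q : ℂ := 𝓕 Q₀ 0 with hq
  have hq0 : q ≠ 0 := fourier_Q₀_zero_ne
  have h := hann (testD k₀) (testD_contDiff k₀) (testD_hasCompactSupport k₀) (testD_jets k₀)
  -- the series is a finite combination of delta sequences
  have hsamp : ∀ (s k : ℤ), 𝓕 Q₀ ((k : ℝ) - ((k₀ : ℝ) + s)) = if k = k₀ + s then q else 0 := by
    intro s k
    have : ((k : ℝ) - ((k₀ : ℝ) + s)) = ((k - (k₀ + s) : ℤ) : ℝ) := by push_cast; ring
    rw [this, fourier_Q₀_int]
    by_cases hk : k = k₀ + s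
    · simp [hk, hq]
    · have : k - (k₀ + s) ≠ 0 := sub_ne_zero.2 hk
      simp [hk, this]
  have hfun : (fun k : ℤ => u k * 𝓕 (testD k₀) k) = fun k : ℤ =>
      (if k = k₀ + 6 then u k * q else 0) + (-3) * (if k = k₀ + 4 then u k * q else 0) +
        3 * (if k = k₀ + 2 then u k * q else 0) - (if k = k₀ + 0 then u k * q else 0) := by
    funext k
    rw [fourier_testD]
    have e6 := hsamp 6 k
    have e4 := hsamp 4 k
    have e2 := hsamp 2 k
    have e0 := hsamp 0 k
    push_cast at e6 e4 e2 e0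
    rw [add_zero] at e0
    rw [e6, e4, e2, e0]
    split_ifs <;> ring
  rw [hfun] at h
  have hδ : ∀ s : ℤ, HasSum (fun k : ℤ => if k = k₀ + s then u k * q else 0) (u (k₀ + s) * q) := by
    intro s
    convert hasSum_ite_eq (k₀ + s) (u (k₀ + s) * q) using 1
    funext k
    split_ifs with hk
    · rw [hk]
    · rfl
  have h' := (((hδ 6).add ((hδ 4).mul_left (-3))).add ((hδ 2).mul_left 3)).sub (hδ 0)
  have heq := h.unique h'
  rw [add_zero] at heq
  have : (u (k₀ + 6) - 3 * u (k₀ + 4) + 3 * u (k₀ + 2) - u k₀) * q = 0 := by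
    linear_combination -heq
  exact (mul_eq_zero.1 this).resolve_right hq0

/-- Anchor of this helper file (registered obligation): the trigonometric factor vanishes on the grid. [folklore] -/
theorem rodLemmaE_anchor : ∀ m : ℤ, trigG ((m : ℝ) / 2) = 0 := trigG_half_int

end Summit.AtomisticToContinuum.Crystallization.Theorems.SignedRootRodLemma

end
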